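import Summits.QuantumFields.YangMills.Theorems.HyperbolicRegulatorCurvatureAnchorRStubKunnethFactor
import Mathlib.Analysis.InnerProductSpace.PiL2

/-!
# Stub `stub_kunneth` of line `witten_hessian` (crux `CurvatureAnchorR`, stmt-QuantumFields-18155), part 2: the Hodge gap of one factor

For a well-formed square complex (`SqCx`) with the primal Poincaré inequality (`Poinc k`),
coherent orientations (`Coh`) and the dual Poincaré inequality (`DualPoinc k`), every real
1-cochain `u` on `E` is within `10⁶ k² (‖d₀* u‖²_V + ‖d₁ u‖²_Q)` (in `ℓ²(E)`) of a HARMONIC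
cochain `h` (`d₀* h = 0` on `V`, `d₁ h = 0` on `Q`): `hodge_gap` (operators written out as in
part 1, no new definitions).

Proof: in `W = ℓ²(E) = EuclideanSpace ℝ ↥E` let `R₀ = im d₀`, `R₁ = im d₁†` (ranges of linear
maps built locally, finite-dimensional, hence with orthogonal projections `P₀`, `P₁`); `R₀ ⊥ R₁`
because `d₁ d₀ = 0`; `h := u − P₀ u − P₁ u` is orthogonal to both ranges, which by the two
adjunctions and indicator test functions is harmonicity; `‖P₀ u‖² = ⟨P₀ u, u⟩ = ⟨f, d₀* u⟩_V` for a
mean-zero potential `f` with `‖f‖²_V ≤ 10⁶k² ‖d₀ f‖² = 10⁶k² ‖P₀ u‖²` (`Poinc`), so Cauchy–Schwarz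
gives `‖P₀ u‖² ≤ 10⁶k² ‖d₀* u‖²_V`; dually for `P₁` (`DualPoinc`, constants being `d₁†`-closed on
`E` by `cocurl_const`).  Only Mathlib's `Submodule.starProjection` API and the finite
Cauchy–Schwarz inequality are used.
-/

set_option autoImplicit false

namespace Summit.QuantumFields.YangMills.Cruxes.CurvatureAnchorR.WittenHessian.Kunneth

open scoped BigOperators Classical InnerProductSpace RealInnerProductSpace

/-! ## Two orthogonal ranges in a real inner product space -/

/-- Abstract two-term Hodge decomposition: for orthogonal subspaces `K₀ ⊥ K₁` with orthogonal
projections `P₀`, `P₁`, the vector `u − P₀ u − P₁ u` is orthogonal to both, and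
`‖P₀ u + P₁ u‖² = ⟨P₀ u, u⟩ + ⟨P₁ u, u⟩` with `‖Pᵢ u‖² = ⟨Pᵢ u, u⟩`. -/
theorem hodge_abstract {W : Type*} [NormedAddCommGroup W] [InnerProductSpace ℝ W]
    (K₀ K₁ : Submodule ℝ W) [K₀.HasOrthogonalProjection] [K₁.HasOrthogonalProjection]
    (horth : ∀ a ∈ K₀, ∀ b ∈ K₁, ⟪a, b⟫_ℝ = 0) (u : W) :
    (∀ a ∈ K₀, ⟪a, u - K₀.starProjection u - K₁.starProjection u⟫_ℝ = 0) ∧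
    (∀ b ∈ K₁, ⟪b, u - K₀.starProjection u - K₁.starProjection u⟫_ℝ = 0) ∧
    ⟪K₀.starProjection u + K₁.starProjection u, K₀.starProjection u + K₁.starProjection u⟫_ℝ =
      ⟪K₀.starProjection u, u⟫_ℝ + ⟪K₁.starProjection u, u⟫_ℝ ∧
    ⟪K₀.starProjection u, K₀.starProjection u⟫_ℝ = ⟪K₀.starProjection u, u⟫_ℝ ∧
    ⟪K₁.starProjection u, K₁.starProjection u⟫_ℝ = ⟪K₁.starProjection u, u⟫_ℝ := by
  set p₀ := K₀.starProjection u
  set p₁ := K₁.starProjection u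
  have m₀ : p₀ ∈ K₀ := K₀.starProjection_apply_mem u
  have m₁ : p₁ ∈ K₁ := K₁.starProjection_apply_mem u
  have o₀ : ∀ a ∈ K₀, ⟪a, u - p₀⟫_ℝ = 0 := fun a ha => by
    rw [real_inner_comm]
    exact K₀.starProjection_inner_eq_zero u a ha
  have o₁ : ∀ b ∈ K₁, ⟪b, u - p₁⟫_ℝ = 0 := fun b hb => by
    rw [real_inner_comm]
    exact K₁.starProjection_inner_eq_zero u b hb
  have c01 : ⟪p₀, p₁⟫_ℝ = 0 := horth p₀ m₀ p₁ m₁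
  have c10 : ⟪p₁, p₀⟫_ℝ = 0 := by
    rw [real_inner_comm]
    exact c01
  have q₀ : ⟪p₀, p₀⟫_ℝ = ⟪p₀, u⟫_ℝ := by
    have := o₀ p₀ m₀
    rw [inner_sub_right, sub_eq_zero] at this
    exact this.symm
  have q₁ : ⟪p₁, p₁⟫_ℝ = ⟪p₁, u⟫_ℝ := by
    have := o₁ p₁ m₁
    rw [inner_sub_right, sub_eq_zero] at this
    exact this.symm
  refine ⟨fun a ha => ?_, fun b hb => ?_, ?_, q₀, q₁⟩
  · rw [inner_sub_right, o₀ a ha, horth a ha p₁ m₁, sub_zero]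
  · have : u - p₀ - p₁ = (u - p₁) - p₀ := by abel
    rw [this, inner_sub_right, o₁ b hb, real_inner_comm, horth p₀ m₀ b hb, sub_zero]
  · rw [inner_add_left, inner_add_right, inner_add_right, c01, c10, q₀, q₁]
    ring

/-- The `ℓ²(E)` inner product of two restricted cochains is the `E`-sum of the products. -/
theorem inner_toLp (E : Finset ℕ) (u v : ℕ → ℝ) :
    ⟪(WithLp.toLp 2 (fun e : ↥E => u e.1) : EuclideanSpace ℝ ↥E),
      (WithLp.toLp 2 (fun e : ↥E => v e.1) : EuclideanSpace ℝ ↥E)⟫_ℝ = ∑ e ∈ E, u e * v e := by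
  simp only [PiLp.inner_apply]
  rw [← Finset.sum_coe_sort E]
  simp [mul_comm]

/-! ## The Hodge gap of the factor -/

/-- **Hodge gap of one factor.**  Under `SqCx`, `Poinc k`, `Coh`, `DualPoinc k`, every cochain `u`
is within `10⁶ k² (∑_V (d₀* u)² + ∑_Q (d₁ u)²)` in `ℓ²(E)` of a harmonic cochain `h`
(`d₀* h = 0` on `V`, `d₁ h = 0` on `Q`). -/
theorem hodge_gap {k : ℕ} {V E Q : Finset ℕ} {σ τ : ℕ → ℕ} {bd : ℕ → Fin 4 → ℕ × Bool}
    (hS : SqCx V E Q σ τ bd) (hP : Poinc k V E σ τ) (hC : Coh Q bd) (hD : DualPoinc k E Q bd)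
    (u : ℕ → ℝ) :
    ∃ h : ℕ → ℝ,
      (∀ x ∈ V, (∑ e ∈ E.filter (fun e => τ e = x), h e) -
        (∑ e ∈ E.filter (fun e => σ e = x), h e) = 0) ∧
      (∀ q ∈ Q, ∑ i : Fin 4, (if (bd q i).2 then (1 : ℝ) else -1) * h (bd q i).1 = 0) ∧
      ∑ e ∈ E, (u e - h e) ^ 2 ≤ 10 ^ 6 * (k : ℝ) ^ 2 *
        ((∑ x ∈ V, ((∑ e ∈ E.filter (fun e => τ e = x), u e) -
            (∑ e ∈ E.filter (fun e => σ e = x), u e)) ^ 2) +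
          ∑ q ∈ Q, (∑ i : Fin 4, (if (bd q i).2 then (1 : ℝ) else -1) * u (bd q i).1) ^ 2) := by
  -- an elementary absorption step: `S² ≤ B·S`, `S, B ≥ 0` give `S ≤ B`
  have absorb : ∀ {S B : ℝ}, 0 ≤ S → 0 ≤ B → S ^ 2 ≤ B * S → S ≤ B := by
    intro S B hS0 hB0 hSB
    rcases hS0.eq_or_lt with h0 | hpos
    · rw [← h0]
      exact hB0
    · exact le_of_mul_le_mul_right (by nlinarith [hSB]) hpos
  obtain ⟨h1, h2, h3⟩ := sqCx_elim hS
  have hE : ∀ e ∈ E, σ e ∈ V ∧ τ e ∈ V := fun e he => ⟨(h1 e he).1, (h1 e he).2.1⟩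
  have hQE : ∀ q ∈ Q, ∀ i, (bd q i).1 ∈ E := fun q hq => (h2 q hq).1
  have hQc : ∀ q ∈ Q, (∀ i, (if (bd q i).2 then τ (bd q i).1 else σ (bd q i).1) =
        (if (bd q (i + 1)).2 then σ (bd q (i + 1)).1 else τ (bd q (i + 1)).1)) ∧
      (fun i => if (bd q i).2 then σ (bd q i).1 else τ (bd q i).1).Injective :=
    fun q hq => (h2 q hq).2
  -- `ℓ²(E)`, restriction, gradient and co-curl as linear maps (local)
  let resE : (ℕ → ℝ) →ₗ[ℝ] EuclideanSpace ℝ ↥E :=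
    { toFun := fun v => WithLp.toLp 2 (fun e : ↥E => v e.1)
      map_add' := fun v v' => by
        ext e
        simp
      map_smul' := fun c v => by
        ext e
        simp }
  let gradE : (ℕ → ℝ) →ₗ[ℝ] (ℕ → ℝ) :=
    { toFun := fun f e => f (τ e) - f (σ e)
      map_add' := fun f f' => by
        funext e
        simp only [Pi.add_apply]
        ring
      map_smul' := fun c f => by
        funext e
        simp only [Pi.smul_apply, smul_eq_mul, RingHom.id_apply]
        ring }
  let cocE : (ℕ → ℝ) →ₗ[ℝ] (ℕ → ℝ) :=
    { toFun := fun g e => ∑ q ∈ Q, ∑ i : Fin 4,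
        if (bd q i).1 = e then (if (bd q i).2 then g q else -g q) else 0
      map_add' := fun g g' => by
        funext e
        simp only [Pi.add_apply, ← Finset.sum_add_distrib]
        refine Finset.sum_congr rfl fun q _ => Finset.sum_congr rfl fun i _ => ?_
        split_ifs <;> ring
      map_smul' := fun c g => by
        funext e
        simp only [Pi.smul_apply, smul_eq_mul, RingHom.id_apply, Finset.mul_sum]
        refine Finset.sum_congr rfl fun q _ => Finset.sum_congr rfl fun i _ => ?_
        split_ifs <;> ring }
  have resE_apply : ∀ (v : ℕ → ℝ) (e : ↥E), resE v e = v e.1 := fun _ _ => rfl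
  have gradE_apply : ∀ (f : ℕ → ℝ) (e : ℕ), gradE f e = f (τ e) - f (σ e) := fun _ _ => rfl
  have cocE_apply : ∀ (g : ℕ → ℝ) (e : ℕ), cocE g e = ∑ q ∈ Q, ∑ i : Fin 4,
      if (bd q i).1 = e then (if (bd q i).2 then g q else -g q) else 0 := fun _ _ => rfl
  have inner_resE : ∀ v v' : ℕ → ℝ, ⟪resE v, resE v'⟫_ℝ = ∑ e ∈ E, v e * v' e :=
    fun v v' => inner_toLp E v v'
  -- the two ranges `R₀ = im d₀`, `R₁ = im d₁†` in `ℓ²(E)`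
  set R₀ : Submodule ℝ (EuclideanSpace ℝ ↥E) := LinearMap.range (resE ∘ₗ gradE) with hR₀def
  set R₁ : Submodule ℝ (EuclideanSpace ℝ ↥E) := LinearMap.range (resE ∘ₗ cocE) with hR₁def
  have memR₀ : ∀ φ : ℕ → ℝ, resE (gradE φ) ∈ R₀ := fun φ => LinearMap.mem_range.2 ⟨φ, rfl⟩
  have memR₁ : ∀ ψ : ℕ → ℝ, resE (cocE ψ) ∈ R₁ := fun ψ => LinearMap.mem_range.2 ⟨ψ, rfl⟩
  have horth : ∀ a ∈ R₀, ∀ b ∈ R₁, ⟪a, b⟫_ℝ = 0 := by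
    intro a ha b hb
    obtain ⟨f, rfl⟩ := LinearMap.mem_range.1 ha
    obtain ⟨g, rfl⟩ := LinearMap.mem_range.1 hb
    rw [LinearMap.comp_apply, LinearMap.comp_apply, inner_resE]
    simp only [gradE_apply, cocE_apply]
    rw [← sum_mul_curl hQE]
    exact Finset.sum_eq_zero fun q hq => by rw [curl_grad (hQc q hq).1, mul_zero]
  obtain ⟨hR₀, hR₁, hsum, hq₀, hq₁⟩ := hodge_abstract R₀ R₁ horth (resE u)
  set p₀ := R₀.starProjection (resE u) with hp₀def
  set p₁ := R₁.starProjection (resE u) with hp₁def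
  obtain ⟨f, hf⟩ : ∃ f : ℕ → ℝ, resE (gradE f) = p₀ :=
    LinearMap.mem_range.1 (R₀.starProjection_apply_mem (resE u))
  obtain ⟨g, hg⟩ : ∃ g : ℕ → ℝ, resE (cocE g) = p₁ :=
    LinearMap.mem_range.1 (R₁.starProjection_apply_mem (resE u))
  -- the harmonic part
  set h : ℕ → ℝ := fun e => u e - gradE f e - cocE g e with hh
  have hTh : resE h = resE u - p₀ - p₁ := by
    rw [← hf, ← hg]
    ext e
    simp only [hh, resE_apply, PiLp.sub_apply]
  refine ⟨h, ?_, ?_, ?_⟩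
  · -- `d₀* h = 0` on `V`
    intro x hx
    have key : ∀ φ : ℕ → ℝ, ∑ y ∈ V, φ y * ((∑ e ∈ E.filter (fun e => τ e = y), h e) -
        (∑ e ∈ E.filter (fun e => σ e = y), h e)) = 0 := by
      intro φ
      have := hR₀ _ (memR₀ φ)
      rw [← hTh, inner_resE] at this
      simp only [gradE_apply] at this
      rw [sum_mul_dv0 hE]
      refine Eq.trans ?_ this
      exact Finset.sum_congr rfl fun e _ => mul_comm _ _
    have := key fun y => if y = x then 1 else 0
    simpa only [ite_mul, one_mul, zero_mul, Finset.sum_ite_eq', if_pos hx] using this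
  · -- `d₁ h = 0` on `Q`
    intro q hq
    have key : ∀ ψ : ℕ → ℝ, ∑ p ∈ Q, ψ p *
        ∑ i : Fin 4, (if (bd p i).2 then (1 : ℝ) else -1) * h (bd p i).1 = 0 := by
      intro ψ
      have := hR₁ _ (memR₁ ψ)
      rw [← hTh, inner_resE] at this
      simp only [cocE_apply] at this
      rw [sum_mul_curl hQE]
      refine Eq.trans ?_ this
      exact Finset.sum_congr rfl fun e _ => mul_comm _ _
    have := key fun p => if p = q then 1 else 0
    simpa only [ite_mul, one_mul, zero_mul, Finset.sum_ite_eq', if_pos hq] using this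
  · -- the bound
    have hdiff : ∀ e, u e - h e = (gradE f + cocE g) e := fun e => by
      simp only [hh, Pi.add_apply]
      ring
    have hsq : ∑ e ∈ E, (u e - h e) ^ 2 = ⟪p₀ + p₁, p₀ + p₁⟫_ℝ := by
      rw [← hf, ← hg, ← map_add, inner_resE]
      exact Finset.sum_congr rfl fun e _ => by rw [hdiff, sq]
    rw [hsq, hsum, mul_add]
    have c0 : (0 : ℝ) ≤ 10 ^ 6 * (k : ℝ) ^ 2 := by positivity
    refine add_le_add ?_ ?_
    · -- `‖P₀ u‖² ≤ 10⁶ k² ∑_V (d₀* u)²` by `Poinc` for the mean-zero potential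
      set M : ℝ := (∑ j ∈ V, f j) / V.card with hM
      have hPf := hP (fun x => f x - M) (sum_sub_mean V f)
      have ha : ⟪p₀, p₀⟫_ℝ = ∑ e ∈ E, ((f (σ e) - M) - (f (τ e) - M)) ^ 2 := by
        rw [← hf, inner_resE]
        refine Finset.sum_congr rfl fun e _ => ?_
        simp only [gradE_apply]
        ring
      have hS' : ⟪p₀, resE u⟫_ℝ = ∑ x ∈ V, (f x - M) *
          ((∑ e ∈ E.filter (fun e => τ e = x), u e) -
            (∑ e ∈ E.filter (fun e => σ e = x), u e)) := by
        rw [sum_mul_dv0 hE, ← hf, inner_resE]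
        refine Finset.sum_congr rfl fun e _ => ?_
        simp only [gradE_apply]
        ring
      have hCS := Finset.sum_mul_sq_le_sq_mul_sq V (fun x => f x - M)
        (fun x => (∑ e ∈ E.filter (fun e => τ e = x), u e) -
          (∑ e ∈ E.filter (fun e => σ e = x), u e))
      have hnn : 0 ≤ ⟪p₀, resE u⟫_ℝ := by
        rw [← hq₀]
        exact real_inner_self_nonneg
      have hDv : 0 ≤ ∑ x ∈ V, ((∑ e ∈ E.filter (fun e => τ e = x), u e) -
          (∑ e ∈ E.filter (fun e => σ e = x), u e)) ^ 2 :=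
        Finset.sum_nonneg fun x _ => sq_nonneg _
      refine absorb hnn (mul_nonneg c0 hDv) ?_
      calc ⟪p₀, resE u⟫_ℝ ^ 2
          = (∑ x ∈ V, (f x - M) * ((∑ e ∈ E.filter (fun e => τ e = x), u e) -
              (∑ e ∈ E.filter (fun e => σ e = x), u e))) ^ 2 := by rw [hS']
        _ ≤ (∑ x ∈ V, (f x - M) ^ 2) *
              ∑ x ∈ V, ((∑ e ∈ E.filter (fun e => τ e = x), u e) -
                (∑ e ∈ E.filter (fun e => σ e = x), u e)) ^ 2 := hCS
        _ ≤ (10 ^ 6 * (k : ℝ) ^ 2 * ⟪p₀, resE u⟫_ℝ) *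
              ∑ x ∈ V, ((∑ e ∈ E.filter (fun e => τ e = x), u e) -
                (∑ e ∈ E.filter (fun e => σ e = x), u e)) ^ 2 := by
            gcongr
            calc ∑ x ∈ V, (f x - M) ^ 2
                ≤ 10 ^ 6 * (k : ℝ) ^ 2 * ∑ e ∈ E, ((f (σ e) - M) - (f (τ e) - M)) ^ 2 := hPf
              _ = 10 ^ 6 * (k : ℝ) ^ 2 * ⟪p₀, resE u⟫_ℝ := by rw [← ha, hq₀]
        _ = 10 ^ 6 * (k : ℝ) ^ 2 *
              (∑ x ∈ V, ((∑ e ∈ E.filter (fun e => τ e = x), u e) -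
                (∑ e ∈ E.filter (fun e => σ e = x), u e)) ^ 2) * ⟪p₀, resE u⟫_ℝ := by ring
    · -- `‖P₁ u‖² ≤ 10⁶ k² ∑_Q (d₁ u)²` by `DualPoinc` for the mean-zero potential
      set M' : ℝ := (∑ j ∈ Q, g j) / Q.card with hM'
      have hcoc : ∀ e ∈ E, (∑ q ∈ Q, ∑ i : Fin 4,
          if (bd q i).1 = e then (if (bd q i).2 then g q - M' else -(g q - M')) else 0) =
            cocE g e := by
        intro e he
        rw [cocE_apply, cocurl_sub Q bd g (fun _ => M') e, cocurl_const hQc h3 hC M' he, sub_zero]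
      have hDg := hD (fun q => g q - M') (sum_sub_mean Q g)
      have hb : ⟪p₁, p₁⟫_ℝ = ∑ e ∈ E, (∑ q ∈ Q, ∑ i : Fin 4,
          if (bd q i).1 = e then (if (bd q i).2 then g q - M' else -(g q - M')) else 0) ^ 2 := by
        rw [← hg, inner_resE]
        refine Finset.sum_congr rfl fun e he => ?_
        rw [hcoc e he, sq]
      have hS' : ⟪p₁, resE u⟫_ℝ = ∑ q ∈ Q, (g q - M') *
          ∑ i : Fin 4, (if (bd q i).2 then (1 : ℝ) else -1) * u (bd q i).1 := by
        rw [sum_mul_curl hQE, ← hg, inner_resE]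
        exact Finset.sum_congr rfl fun e he => by rw [hcoc e he, mul_comm]
      have hCS := Finset.sum_mul_sq_le_sq_mul_sq Q (fun q => g q - M')
        (fun q => ∑ i : Fin 4, (if (bd q i).2 then (1 : ℝ) else -1) * u (bd q i).1)
      have hnn : 0 ≤ ⟪p₁, resE u⟫_ℝ := by
        rw [← hq₁]
        exact real_inner_self_nonneg
      have hCu : 0 ≤ ∑ q ∈ Q,
          (∑ i : Fin 4, (if (bd q i).2 then (1 : ℝ) else -1) * u (bd q i).1) ^ 2 :=
        Finset.sum_nonneg fun q _ => sq_nonneg _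
      refine absorb hnn (mul_nonneg c0 hCu) ?_
      calc ⟪p₁, resE u⟫_ℝ ^ 2
          = (∑ q ∈ Q, (g q - M') *
              ∑ i : Fin 4, (if (bd q i).2 then (1 : ℝ) else -1) * u (bd q i).1) ^ 2 := by
            rw [hS']
        _ ≤ (∑ q ∈ Q, (g q - M') ^ 2) *
              ∑ q ∈ Q, (∑ i : Fin 4, (if (bd q i).2 then (1 : ℝ) else -1) * u (bd q i).1) ^ 2 :=
            hCS
        _ ≤ (10 ^ 6 * (k : ℝ) ^ 2 * ⟪p₁, resE u⟫_ℝ) *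
              ∑ q ∈ Q, (∑ i : Fin 4, (if (bd q i).2 then (1 : ℝ) else -1) * u (bd q i).1) ^ 2 := by
            gcongr
            calc ∑ q ∈ Q, (g q - M') ^ 2
                ≤ 10 ^ 6 * (k : ℝ) ^ 2 * ∑ e ∈ E, (∑ q ∈ Q, ∑ i : Fin 4,
                    if (bd q i).1 = e then (if (bd q i).2 then g q - M' else -(g q - M'))
                    else 0) ^ 2 := hDg
              _ = 10 ^ 6 * (k : ℝ) ^ 2 * ⟪p₁, resE u⟫_ℝ := by rw [← hb, hq₁]
        _ = 10 ^ 6 * (k : ℝ) ^ 2 *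
              (∑ q ∈ Q, (∑ i : Fin 4, (if (bd q i).2 then (1 : ℝ) else -1) * u (bd q i).1) ^ 2) *
              ⟪p₁, resE u⟫_ℝ := by ring

end Summit.QuantumFields.YangMills.Cruxes.CurvatureAnchorR.WittenHessian.Kunneth
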